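import Summits.FinalStateConjecture.FinalStateConjecture.Theorems.EIHFluxBalanceInertialRecessionChartCalculus
import Summits.FinalStateConjecture.FinalStateConjecture.Theorems.EIHFluxBalanceInertialRecessionRechart
import Summits.FinalStateConjecture.FinalStateConjecture.Theorems.EIHFluxBalanceInertialRecessionDeviation

/-!
# Route EIHFluxBalance — `InertialRecession`, the case of ONE hole AT REST in the lab

Helper file for the crux `stmt-FinalStateConjecture-10166`
(`Summit.FinalStateConjecture.FinalStateConjecture.Theses.EIHFluxBalance.InertialRecession`).

The kinematic ("re-charting") half of the crux in its simplest non-dispersive instance: the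
hypothesis of `InertialRecession` with `N = 1` and a STATIC modulation (`Λ(t) = 1`, `ξ(t) = ξ₀`)
implies its conclusion. Then the lab ansatz is the translated Kerr–Schild form
`g_{M,a}(· − c₀)`, `c₀ = (0, ξ₀)`, the hole chart is the lab chart re-timed to be defined on the
whole exterior `{r(· − c₀) > r₊}` (file `…Rechart`), its rest-frame time IS lab time, so the
hypothesis' lab-slab exhaustion transfers by monotonicity of `J⁻`; the flat chart is the lab chart
on `{x⁰ > τ₀ + 1, r(· − c₀) > ρ(x⁰)}`, `ρ(t) = r₊ + 1 + √t`, converging to `η` by the decay of the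
Kerr–Schild tail (file `…ChartCalculus`, sibling seat). For moving holes the rest-frame slabs `{t*ᵢ = τ}` are NOT
lab slabs and the transfer needs genuine causal geometry (see the prover analysis attached to the
item); that, and the dynamics (`accelerations → 0`, mean velocities converge), are the open part.
-/

noncomputable section

open scoped Manifold ContDiff Topology BigOperators ENNReal
open Filter Set TopologicalSpace Literature.Geometry.Lorentzian

namespace Summit.FinalStateConjecture.FinalStateConjecture.Theorems

/-! ### A small generic fact -/

/-- Restricting a chart along an inclusion of open domains preserves the open-embedding property
on open subsets mapped into the set where the chart is an open embedding. [folklore] -/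
theorem isOpenEmbedding_restrict_comp_inclusion {Y : Type*} [TopologicalSpace Y]
    {U V : Opens E4} (h : V ≤ U) {Φ : U → Y} {L : Set U} (hL : IsOpen L)
    (hemb : Topology.IsOpenEmbedding (L.restrict Φ)) {W : Set V} (hW : IsOpen W)
    (hWL : ∀ x ∈ W, Opens.inclusion h x ∈ L) :
    Topology.IsOpenEmbedding (W.restrict (Φ ∘ Opens.inclusion h)) := by
  let j : W → L := fun x ↦ ⟨Opens.inclusion h x.1, hWL x.1 x.2⟩
  have hg0 : Topology.IsOpenEmbedding (fun y : L ↦ (y.1.1 : E4)) :=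
    U.isOpen.isOpenEmbedding_subtypeVal.comp hL.isOpenEmbedding_subtypeVal
  have hg1 : Topology.IsOpenEmbedding (fun x : W ↦ (x.1.1 : E4)) :=
    V.isOpen.isOpenEmbedding_subtypeVal.comp hW.isOpenEmbedding_subtypeVal
  have hj : Topology.IsOpenEmbedding j := Topology.IsOpenEmbedding.of_comp j hg0 hg1
  exact hemb.comp hj

/-! ### The static one-hole case of `InertialRecession` -/

/-- **`InertialRecession`, case `N = 1`, hole at rest in the lab chart.** If a vacuum Cauchy
development satisfies the hypothesis of `InertialRecession` with one hole whose modulation is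
static (`Λ 0 t = 1`, `ξ 0 t = ξ 0 0` for all `t`), then it carries a `C²` final state
decomposition with one sub-extremal hole, `O' = J⁺(ι X) ∩ I⁻(d.charted)` and exhaustive charts.
Construction (`τ₁ = τ₀ + 1`, `c₀ = (0, ξ₀)`): motion `(1, c₀)`; hole chart `x ↦ Φ(T x)` on the
boosted exterior `{r(x − c₀) > r₊}` with `T` the time reparametrisation of
`exists_timeReparamMap` (so it is `Φ` on `{x⁰ ≥ τ₁}`); excision `ρ(t) = r₊ + 1 + √t`; flat
domain `{x⁰ > τ₁, r(x − c₀) > ρ(x⁰)}` with flat chart `Φ`; region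
`O' = J⁺(ι X) ∩ I⁻(Φ{x⁰ > τ₁, r > r₊}) ⊆ O`; near-zone and radiation-zone convergence from
`Φ^* g − g_{M,a}(· − c₀) → 0` in `C³` on lab slabs (`tendsto_deviationCk_backgroundOn_of_kerr_sub` and the
locality lemma `deviationExtend_eventuallyEq_of_pullbackBilin_eq`); covering and exhaustion from
the hypothesis' lab-slab exhaustion at times `τ₁` and `τ₂ > τ₁` (hole time = lab time), splitting
a lab slab into its near zone `{r ≤ ρ + 1}` and its far part; the near-zone radii `R(τ) = ρ(τ) + 1`
are honest (`R → ∞`, `R ≥ max(r₊, 0) + 1`).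
[folklore bookkeeping; the physics of the crux is elsewhere] -/
theorem inertialRecession_staticHole
    (X : Type) [TopologicalSpace X] [ChartedSpace E3 X]
    [IsManifold (𝓡 3) ((⊤ : ℕ∞) : WithTop ℕ∞) X] [ConnectedSpace X]
    (D : InitialDataSet (𝓡 3) X) (𝒟 : VacuumCauchyDevelopment D)
    (M a rin : Fin 1 → ℝ) (Λ : Fin 1 → ℝ → lorentzGroup) (ξ : Fin 1 → ℝ → E3) (γ κ τ₀ : ℝ)
    (U : Opens E4) (Φ : U → 𝒟.carrier) (O : Set 𝒟.carrier)
    (hΛ : ∀ t, Λ 0 t = 1) (hξ : ∀ t, ξ 0 t = ξ 0 0)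
    (h : (∀ i, Kerr.IsSubextremal (M i) (a i) ∧ Kerr.rMinus (M i) (a i) < rin i ∧ rin i < Kerr.rPlus (M i) (a i)) ∧ (∀ i t, |((Λ i t : E4 ≃L[ℝ] E4) (E4.basisVector 0)) 0| ≤ γ) ∧ (∀ i, ContDiff ℝ ((⊤ : ℕ∞) : WithTop ℕ∞) (ξ i) ∧ ContDiff ℝ ((⊤ : ℕ∞) : WithTop ℕ∞) (fun t ↦ ((Λ i t : E4 ≃L[ℝ] E4) : E4 →L[ℝ] E4))) ∧ (∀ i j, i ≠ j → Tendsto (fun t ↦ ‖ξ i t - ξ j t‖) atTop atTop) ∧ (0 < κ ∧ κ < 1 ∧ ∀ i, ∀ᶠ t in atTop, ‖ξ i t‖ ≤ κ ^ 2 * t) ∧ ({x : E4 | τ₀ < x 0 ∧ ∀ i, rin i < Kerr.radius (a i) (poincareInv (Λ i (x 0)) (E4.ofTimeSpace (x 0) (ξ i (x 0))) x)} ⊆ (U : Set E4)) ∧ let B : ModelBackground := ⟨U, fun x ↦ Minkowski.bilin + ∑ i, (boostedKerrBilin (Λ i (x 0)) (E4.ofTimeSpace (x 0) (ξ i (x 0)))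 (M i) (a i) x - Minkowski.bilin), fun x ↦ x 0, E4.spatialNorm⟩; ContMDiff 𝓘(ℝ, E4) (𝓡 4) ((⊤ : ℕ∞) : WithTop ℕ∞) Φ ∧ Topology.IsOpenEmbedding ((B.lateRegion τ₀).restrict Φ) ∧ Φ '' {x : U | τ₀ < x.1 0 ∧ ∀ i, Kerr.rPlus (M i) (a i) < Kerr.radius (a i) (poincareInv (Λ i (x.1 0)) (E4.ofTimeSpace (x.1 0) (ξ i (x.1 0))) x.1)} ⊆ O ∧ Tendsto (fun t ↦ 𝒟.toSpacetime.deviationCk B Φ 3 t) atTop (𝓝 0) ∧ Tendsto (fun t : ℝ ↦ ⨆ x ∈ {x : U | x.1 0 = t ∧ E4.spatialNorm x.1 ≤ κ * t}, ⨆ (m : ℕ) (_ : m ≤ 3), ENNReal.ofReal (1 + √(√((⨅ i, ‖E4.spatial x.1 - ξ i t‖) ^ 7))) * ‖iteratedFDeriv ℝ m (𝒟.toSpacetime.deviationExtend B Φ) x.1‖ₑ) atTop (𝓝 0) ∧ O = Summit.FinalStateConjecture.exteriorOf 𝒟.toCauchyDevelopment (Φ '' {x : U | τ₀ < x.1 0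 ∧ ∀ i, Kerr.rPlus (M i) (a i) < Kerr.radius (a i) (poincareInv (Λ i (x.1 0)) (E4.ofTimeSpace (x.1 0) (ξ i (x.1 0))) x.1)}) ∧ ∀ t₁ : ℝ, τ₀ < t₁ → O \ Φ '' {x : U | t₁ < x.1 0 ∧ ∀ i, Kerr.rPlus (M i) (a i) < Kerr.radius (a i) (poincareInv (Λ i (x.1 0)) (E4.ofTimeSpace (x.1 0) (ξ i (x.1 0))) x.1)} ⊆ 𝒟.metric.causalPast 𝒟.timeOrientation (Φ '' {x : U | x.1 0 = t₁ ∧ ∀ i, Kerr.rPlus (M i) (a i) < Kerr.radius (a i) (poincareInv (Λ i (x.1 0)) (E4.ofTimeSpace (x.1 0) (ξ i (x.1 0))) x.1)})) :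
    ∃ (O : Set 𝒟.carrier) (d : FinalStateDecomposition 𝒟.toSpacetime O 2), (∀ i, Kerr.IsSubextremal (d.mass i) (d.spin i)) ∧ O = Summit.FinalStateConjecture.exteriorOf 𝒟.toCauchyDevelopment d.charted ∧ Summit.FinalStateConjecture.HasExhaustiveCharts d := by
  obtain ⟨hpar, -, -, -, -, hU, hB⟩ := h
  obtain ⟨hΦ, hemb, himO, hdev, -, hO, hexh⟩ := hB
  obtain ⟨hsub, -, hrin'⟩ := hpar 0
  -- notation
  obtain ⟨c₀, hc₀⟩ : ∃ c₀ : E4, c₀ = E4.ofTimeSpace 0 (ξ 0 0) := ⟨_, rfl⟩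
  let B : ModelBackground := ⟨U, fun x ↦ Minkowski.bilin + ∑ i, (boostedKerrBilin (Λ i (x 0))
    (E4.ofTimeSpace (x 0) (ξ i (x 0))) (M i) (a i) x - Minkowski.bilin), fun x ↦ x 0,
    E4.spatialNorm⟩
  have hM₀pos : 0 < M 0 := hsub.pos
  have hrp : 0 < Kerr.rPlus (M 0) (a 0) := by
    have h1 : 0 ≤ √(M 0 ^ 2 - a 0 ^ 2) := Real.sqrt_nonneg _
    show 0 < M 0 + √(M 0 ^ 2 - a 0 ^ 2)
    linarith
  have hmax : max (Kerr.rPlus (M 0) (a 0)) 0 = Kerr.rPlus (M 0) (a 0) := max_eq_left hrp.le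
  -- the hole's radius in the lab chart: static, centred at `c₀`
  have hpinv : ∀ (c x : E4), poincareInv 1 c x = x - c := fun _ _ ↦ rfl
  have hrad : ∀ (t : ℝ) (x : E4),
      Kerr.radius (a 0) (poincareInv 1 (E4.ofTimeSpace t (ξ 0 0)) x) =
        Kerr.radius (a 0) (x - c₀) := by
    intro t x
    rw [hpinv]
    apply Kerr.radius_eq_of_spatial_eq
    rw [map_sub, map_sub, E4.spatial_ofTimeSpace, hc₀, E4.spatial_ofTimeSpace]
  simp only [Fin.forall_fin_one, hΛ, hξ] at hU himO hO hexh
  simp only [hrad] at hU himO hO hexh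
  -- the lab ansatz is the translated Kerr–Schild form
  have hBb : ∀ x : E4, B.bilin x = Kerr.bilin (M 0) (a 0) (x - c₀) := by
    intro x
    show Minkowski.bilin + ∑ i, (boostedKerrBilin (Λ i (x 0)) (E4.ofTimeSpace (x 0) (ξ i (x 0)))
      (M i) (a i) x - Minkowski.bilin) = Kerr.bilin (M 0) (a 0) (x - c₀)
    rw [Fin.sum_univ_one, hΛ, hξ]
    have e1 : boostedKerrBilin 1 (E4.ofTimeSpace (x 0) (ξ 0 0)) (M 0) (a 0) x =
        Kerr.bilin (M 0) (a 0) (x - E4.ofTimeSpace (x 0) (ξ 0 0)) := by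
      ext v w
      rfl
    have e2 : Kerr.bilin (M 0) (a 0) (x - E4.ofTimeSpace (x 0) (ξ 0 0)) =
        Kerr.bilin (M 0) (a 0) (x - c₀) := by
      apply kerr_bilin_eq_of_spatial_eq
      rw [map_sub, map_sub, E4.spatial_ofTimeSpace, hc₀, E4.spatial_ofTimeSpace]
    rw [e1, e2]
    abel
  have hBt : ∀ x : E4, B.time x = x 0 := fun _ ↦ rfl
  -- `C²` lab convergence
  have hdev2 : Tendsto (fun t ↦ 𝒟.toSpacetime.deviationCk B Φ 2 t) atTop (𝓝 0) :=
    tendsto_of_tendsto_of_tendsto_of_le_of_le tendsto_const_nhds hdev (fun _ ↦ zero_le)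
      fun t ↦ 𝒟.toSpacetime.deviationCk_mono B Φ (by norm_num) t
  -- the hypothesis' region lies to the future of the data; the late exterior sets
  have hOJ : O ⊆ 𝒟.metric.causalFuture 𝒟.timeOrientation (range 𝒟.embed) := by
    rw [hO]; exact inter_subset_left
  -- time reparametrisation and the hole chart
  obtain ⟨T, hT, hT0, hTs, hTid⟩ := exists_timeReparamMap τ₀
  let Ω : Opens E4 := boostedKerrExterior 1 c₀ (M 0) (a 0)
  have hΩmem : ∀ {x : E4}, x ∈ Ω ↔ Kerr.rPlus (M 0) (a 0) < Kerr.radius (a 0) (x - c₀) := by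
    intro x
    rw [mem_boostedKerrExterior, Kerr.mem_exterior, hmax, hpinv]
  have hradT : ∀ x : E4, Kerr.radius (a 0) (T x - c₀) = Kerr.radius (a 0) (x - c₀) := fun x ↦
    Kerr.radius_eq_of_spatial_eq (a 0) (by rw [map_sub, map_sub, hTs])
  have hΩU : ∀ x ∈ Ω, T x ∈ U := by
    intro x hx
    refine hU ⟨hT0 x, ?_⟩
    rw [hradT]
    exact hrin'.trans (hΩmem.mp hx)
  have hΩU' : ∀ x ∈ Ω, τ₀ + 1 ≤ x 0 → x ∈ U := by
    intro x hx hx0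
    have := hΩU x hx
    rwa [hTid x hx0] at this
  let chart : Ω → 𝒟.toSpacetime.carrier := fun x ↦ Φ ⟨T x.1, hΩU x.1 x.2⟩
  have hchart : ∀ x, chart x = Φ ⟨T x.1, hΩU x.1 x.2⟩ := fun _ ↦ rfl
  have hchartC : ContMDiff 𝓘(ℝ, E4) (𝓡 4) ∞ chart :=
    contMDiff_rechart (hΩ := hΩU) (hΨ := hchart) hT hΦ
  -- the hole background: its time is lab time, its form the lab ansatz
  let Bh : ModelBackground := boostedKerrBackground 1 c₀ (M 0) (a 0)
  have hBht : ∀ x : E4, Bh.time x = x 0 := by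
    intro x
    show (poincareInv 1 c₀ x) 0 = x 0
    rw [hpinv, hc₀]
    simp
  have hBhb : ∀ x : E4, Bh.bilin x = Kerr.bilin (M 0) (a 0) (x - c₀) := by
    intro x
    show boostedKerrBilin 1 c₀ (M 0) (a 0) x = _
    ext v w
    rfl
  have hBhr : ∀ x : E4, Bh.radius x = Kerr.radius (a 0) (x - c₀) := fun _ ↦ rfl
  -- late exterior sets in the lab chart
  let E : ℝ → Set U := fun t ↦ {x : U | t < x.1 0 ∧ Kerr.rPlus (M 0) (a 0) < Kerr.radius (a 0) (x.1 - c₀)}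
  let S : ℝ → Set U := fun t ↦ {x : U | x.1 0 = t ∧ Kerr.rPlus (M 0) (a 0) < Kerr.radius (a 0) (x.1 - c₀)}
  have hE_anti : ∀ {t t' : ℝ}, t ≤ t' → E t' ⊆ E t := fun htt' x hx ↦ ⟨lt_of_le_of_lt htt' hx.1, hx.2⟩
  -- the hole chart on its late region is the lab chart on `E (τ₀ + 1)`
  have himg : chart '' Bh.lateRegion (τ₀ + 1) = Φ '' E (τ₀ + 1) := by
    ext p
    constructor
    · rintro ⟨x, hx, rfl⟩
      have hx1 : τ₀ + 1 < x.1 0 := lt_of_lt_of_eq (show τ₀ + 1 < Bh.time x.1 from hx) (hBht x.1)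
      have hxU : x.1 ∈ U := hΩU' x.1 x.2 hx1.le
      refine ⟨⟨x.1, hxU⟩, ⟨hx1, hΩmem.mp x.2⟩, ?_⟩
      exact (rechart_apply_of_le hTid hΩU hchart x hx1.le hxU).symm
    · rintro ⟨y, hy, rfl⟩
      have hyΩ : y.1 ∈ Ω := hΩmem.mpr hy.2
      refine ⟨⟨y.1, hyΩ⟩, ?_, ?_⟩
      · show τ₀ + 1 < Bh.time y.1
        rw [hBht]
        exact hy.1
      · exact rechart_apply_of_le hTid hΩU hchart ⟨y.1, hyΩ⟩ hy.1.le y.2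
  have hslab : ∀ t : ℝ, τ₀ + 1 ≤ t → Φ '' S t ⊆ chart '' Bh.timeSlab t := by
    rintro t ht _ ⟨y, hy, rfl⟩
    have hyΩ : y.1 ∈ Ω := hΩmem.mpr hy.2
    refine ⟨⟨y.1, hyΩ⟩, ?_, ?_⟩
    · show Bh.time y.1 = t
      rw [hBht]
      exact hy.1
    · exact rechart_apply_of_le hTid hΩU hchart ⟨y.1, hyΩ⟩ (hy.1.symm ▸ ht) y.2
  -- the open embedding property of the hole chart on its late region
  have hlateOpen : IsOpen (Bh.lateRegion (τ₀ + 1)) := by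
    have hc : Continuous fun x : Ω ↦ Bh.time x.1 := by
      have : (fun x : Ω ↦ Bh.time x.1) = fun x : Ω ↦ x.1 0 := funext fun x ↦ hBht x.1
      rw [this]
      exact (PiLp.continuous_apply 2 _ 0).comp continuous_subtype_val
    exact isOpen_lt continuous_const hc
  have hembh : Topology.IsOpenEmbedding ((Bh.lateRegion (τ₀ + 1)).restrict chart) := by
    refine isOpenEmbedding_restrict_rechart hTid hΩU hchart hemb hlateOpen ?_ ?_
    · intro x hx
      exact (lt_of_lt_of_eq (show τ₀ + 1 < Bh.time x.1 from hx) (hBht x.1)).le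
    · intro x hx
      exact hΩU' x.1 x.2 (lt_of_lt_of_eq (show τ₀ + 1 < Bh.time x.1 from hx) (hBht x.1)).le
  have hopen : IsOpen (Φ '' E (τ₀ + 1)) := by
    rw [← himg, ← Set.range_restrict]
    exact hembh.isOpen_range
  -- the new region
  let O' : Set 𝒟.carrier := Summit.FinalStateConjecture.exteriorOf 𝒟.toCauchyDevelopment (Φ '' E (τ₀ + 1))
  have hO'O : O' ⊆ O := by
    rw [hO]
    exact inter_subset_inter_right _
      (LorentzianMetric.chronologicalFuture_mono (image_mono (hE_anti (by linarith))))
  have hEO' : Φ '' E (τ₀ + 1) ⊆ O' :=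
    subset_inter (((image_mono (hE_anti (by linarith))).trans himO).trans hOJ)
      (subset_chronologicalPast_of_isOpen 𝒟.metric 𝒟.timeOrientation hopen)
  have hlateO' : chart '' Bh.lateRegion (τ₀ + 1) ⊆ O' := by
    rw [himg]
    exact hEO'
  -- near-zone convergence: the hole chart's deviation is the lab deviation on late slabs
  have hN : IsOpen ((Ω : Set E4) ∩ {y : E4 | τ₀ + 1 < y 0}) :=
    Ω.isOpen.inter (isOpen_lt continuous_const (PiLp.continuous_apply 2 _ 0))
  have hN₁ : (Ω : Set E4) ∩ {y : E4 | τ₀ + 1 < y 0} ⊆ (Bh.domain : Set E4) := fun y hy ↦ hy.1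
  have hN₂ : (Ω : Set E4) ∩ {y : E4 | τ₀ + 1 < y 0} ⊆ (B.domain : Set E4) := fun y hy ↦
    hΩU' y hy.1 hy.2.le
  have hdevEq : ∀ z : E4, z ∈ (Ω : Set E4) ∩ {y : E4 | τ₀ + 1 < y 0} →
      𝒟.toSpacetime.deviationExtend Bh chart =ᶠ[𝓝 z] 𝒟.toSpacetime.deviationExtend B Φ := by
    intro z hz
    refine deviationExtend_eventuallyEq_of_pullbackBilin_eq 𝒟.toSpacetime hN hz hN₁ hN₂ ?_ ?_
    · intro y _
      rw [hBhb, hBb]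
    · intro y hy
      exact pullbackBilin_rechart hT hTid hΩU hchart hΦ ⟨y, hN₁ hy⟩ hy.2 (hN₂ hy)
  have hdevh : ∀ τ, τ₀ + 1 < τ → 𝒟.toSpacetime.deviationCk Bh chart 2 τ ≤ 𝒟.toSpacetime.deviationCk B Φ 2 τ := by
    intro τ hτ
    refine iSup₂_le fun m hm ↦ iSup₂_le fun z hz ↦ ?_
    obtain ⟨x, hx, rfl⟩ := hz
    have hx0 : x.1 0 = τ := (hBht x.1).symm.trans (show Bh.time x.1 = τ from hx)
    have hxN : x.1 ∈ (Ω : Set E4) ∩ {y : E4 | τ₀ + 1 < y 0} :=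
      ⟨x.2, by rw [Set.mem_setOf_eq, hx0]; exact hτ⟩
    rw [((hdevEq x.1 hxN).iteratedFDeriv ℝ m).eq_of_nhds]
    have hmem : (x.1 : E4) ∈ Subtype.val '' B.timeSlab τ := ⟨⟨x.1, hN₂ hxN⟩, hx0, rfl⟩
    exact enorm_iteratedFDeriv_le_supCkENorm hm hmem _
  have htrunc : ∀ R : ℝ → ℝ,
      Tendsto (fun τ ↦ 𝒟.toSpacetime.truncDeviationCk Bh chart 2 (R τ) τ) atTop (𝓝 0) := by
    intro R
    refine tendsto_of_tendsto_of_tendsto_of_le_of_le' tendsto_const_nhds hdev2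
      (Eventually.of_forall fun _ ↦ zero_le) ?_
    filter_upwards [eventually_gt_atTop (τ₀ + 1)] with τ hτ
    exact (𝒟.toSpacetime.truncDeviationCk_le_deviationCk Bh chart 2 (R τ) τ).trans (hdevh τ hτ)
  -- the excision radius and the flat domain
  set ρ : ℝ → ℝ := fun t ↦ Kerr.rPlus (M 0) (a 0) + 1 + √t with hρ
  have hρc : Continuous ρ := continuous_const.add Real.continuous_sqrt
  have hρge : ∀ t, Kerr.rPlus (M 0) (a 0) + 1 ≤ ρ t := fun t ↦ le_add_of_nonneg_right (Real.sqrt_nonneg t)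
  have hρtop : Tendsto ρ atTop atTop :=
    tendsto_atTop_add_const_left _ _ Real.tendsto_sqrt_atTop
  have hρdiv : Tendsto (fun t ↦ ρ t / t) atTop (𝓝 0) := by
    have h1 : Tendsto (fun t : ℝ ↦ (Kerr.rPlus (M 0) (a 0) + 1) / t) atTop (𝓝 0) :=
      tendsto_const_nhds.div_atTop tendsto_id
    have h2 : Tendsto (fun t : ℝ ↦ √t / t) atTop (𝓝 0) := by
      simp_rw [Real.sqrt_div_self]
      exact tendsto_inv_atTop_zero.comp Real.tendsto_sqrt_atTop
    simpa [hρ, add_div] using h1.add h2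
  have hc0 : Continuous fun y : E4 ↦ y 0 := PiLp.continuous_apply 2 _ 0
  have hcr : Continuous fun y : E4 ↦ Kerr.radius (a 0) (y - c₀) :=
    (Kerr.continuous_radius (a 0)).comp (continuous_id.sub continuous_const)
  let U'' : Opens E4 := ⟨{x | (τ₀ + 1) < x 0 ∧ ρ (x 0) < Kerr.radius (a 0) (x - c₀)},
    (isOpen_lt continuous_const hc0).inter (isOpen_lt (hρc.comp hc0) hcr)⟩
  have hU''E : ∀ x ∈ U'', ∀ hx : x ∈ U, (⟨x, hx⟩ : U) ∈ E (τ₀ + 1) := fun x hx _ ↦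
    ⟨hx.1, by linarith [hρge (x 0), hx.2]⟩
  have hU''U : (Minkowski.backgroundOn U'').domain ≤ B.domain := by
    intro x hx
    change (τ₀ + 1) < x 0 ∧ ρ (x 0) < Kerr.radius (a 0) (x - c₀) at hx
    refine hU ⟨by linarith [hx.1], ?_⟩
    linarith [hρge (x 0), hx.2]
  have hU''ρ : ∀ z ∈ U'', ρ (z 0) < Kerr.radius (a 0) (z - c₀) := fun z hz ↦ hz.2
  let flat : (Minkowski.backgroundOn U'').domain → 𝒟.toSpacetime.carrier := Φ ∘ Opens.inclusion hU''U
  have hflatimg : ∀ A : Set (Minkowski.backgroundOn U'').domain, flat '' A ⊆ Φ '' E (τ₀ + 1) := by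
    rintro A _ ⟨x, -, rfl⟩
    exact ⟨Opens.inclusion hU''U x, hU''E x.1 x.2 _, rfl⟩
  have hflat_emb : Topology.IsOpenEmbedding
      (((Minkowski.backgroundOn U'').lateRegion (τ₀ + 1)).restrict flat) := by
    refine isOpenEmbedding_restrict_comp_inclusion hU''U (L := B.lateRegion τ₀)
      (isOpen_lt continuous_const (hc0.comp continuous_subtype_val)) hemb
      (isOpen_lt continuous_const (hc0.comp continuous_subtype_val)) ?_
    intro x hx
    show τ₀ < x.1 0
    have hx' : (τ₀ + 1) < x.1 0 := hx
    linarith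
  have hflat_dev : Tendsto (fun τ ↦ 𝒟.toSpacetime.deviationCk (Minkowski.backgroundOn U'') flat 2 τ)
      atTop (𝓝 0) :=
    tendsto_deviationCk_backgroundOn_of_kerr_sub 𝒟.toSpacetime B hBb hBt hΦ hdev2 hρtop hU''ρ hU''U
  -- splitting a late lab point into near zone / far zone
  have hsplit_late : ∀ t : ℝ, τ₀ + 1 < t → Φ '' E t ⊆
      flat '' (Minkowski.backgroundOn U'').lateRegion t ∪
        chart '' {x : Ω | t < Bh.time x.1 ∧ Bh.radius x.1 ≤ ρ (Bh.time x.1) + 1} := by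
    rintro t ht _ ⟨y, hy, rfl⟩
    by_cases hr : Kerr.radius (a 0) (y.1 - c₀) ≤ ρ (y.1 0) + 1
    · have hyΩ : y.1 ∈ Ω := hΩmem.mpr hy.2
      refine Or.inr ⟨⟨y.1, hyΩ⟩, ⟨?_, ?_⟩, ?_⟩
      · rw [hBht]; exact hy.1
      · rw [hBhr, hBht]; exact hr
      · exact rechart_apply_of_le hTid hΩU hchart ⟨y.1, hyΩ⟩ (ht.le.trans hy.1.le) y.2
    · have hr' : ρ (y.1 0) + 1 < Kerr.radius (a 0) (y.1 - c₀) := lt_of_not_ge hr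
      have hyU'' : y.1 ∈ U'' := ⟨lt_trans ht hy.1, by linarith⟩
      refine Or.inl ⟨⟨y.1, hyU''⟩, ?_, ?_⟩
      · exact hy.1
      · rfl
  have hsplit_slab : ∀ t : ℝ, τ₀ + 1 < t → Φ '' S t ⊆
      flat '' (Minkowski.backgroundOn U'').timeSlab t ∪
        chart '' Bh.truncTimeSlab (ρ t + 1) t := by
    rintro t ht _ ⟨y, hy, rfl⟩
    by_cases hr : Kerr.radius (a 0) (y.1 - c₀) ≤ ρ t + 1
    · have hyΩ : y.1 ∈ Ω := hΩmem.mpr hy.2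
      refine Or.inr ⟨⟨y.1, hyΩ⟩, ⟨?_, ?_⟩, ?_⟩
      · rw [hBht]; exact hy.1
      · rw [hBhr]; exact hr
      · exact rechart_apply_of_le hTid hΩU hchart ⟨y.1, hyΩ⟩ (hy.1.symm ▸ ht.le) y.2
    · have hr' : ρ t + 1 < Kerr.radius (a 0) (y.1 - c₀) := lt_of_not_ge hr
      have hy0 : y.1 0 = t := hy.1
      have hyU'' : y.1 ∈ U'' := by
        refine ⟨?_, ?_⟩
        · show τ₀ + 1 < y.1 0
          rw [hy0]
          exact ht
        · show ρ (y.1 0) < Kerr.radius (a 0) (y.1 - c₀)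
          rw [hy0]
          linarith
      refine Or.inl ⟨⟨y.1, hyU''⟩, ?_, ?_⟩
      · exact hy.1
      · rfl
  -- the decomposition
  let d : FinalStateDecomposition 𝒟.toSpacetime O' 2 :=
    { N := 1
      mass := fun _ ↦ M 0
      spin := fun _ ↦ a 0
      mass_pos := fun _ ↦ hM₀pos
      abs_spin_le_mass := fun _ ↦ (show |a 0| < M 0 from hsub).le
      motion := fun _ ↦ (1, c₀)
      τ₀ := (τ₀ + 1)
      chart := fun _ ↦ chart
      isLateChart := fun _ ↦ ⟨hchartC, hembh, hlateO'⟩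
      tendsto_truncDeviationCk := fun _ R ↦ htrunc fun _ ↦ R
      exists_pairwise_disjoint := fun _ ↦ ⟨0, Subsingleton.pairwise⟩
      excision := fun _ ↦ ρ
      tendsto_excision_div := fun _ ↦ hρdiv
      flatDomain := U''
      setOf_lt_excision_subset_flatDomain := fun x hx ↦ ⟨hx.1, by simpa [hpinv] using hx.2 0⟩
      flatChart := flat
      isLateChart_flat := ⟨hΦ.comp (contMDiff_inclusion hU''U), hflat_emb,
        (hflatimg _).trans hEO'⟩
      tendsto_deviationCk_flat := hflat_dev
      diff_subset_causalPast := by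
        intro p hp
        have hp2 : p ∉ Φ '' E (τ₀ + 1) := by
          intro hp'
          rw [← himg] at hp'
          exact hp.2 (Or.inl (Set.mem_iUnion.mpr ⟨0, hp'⟩))
        have hJ := hexh (τ₀ + 1) (by linarith) ⟨hO'O hp.1, hp2⟩
        refine LorentzianMetric.causalFuture_mono ?_ hJ
        exact (hslab (τ₀ + 1) le_rfl).trans
          ((Set.subset_iUnion (fun _ : Fin 1 ↦ chart '' Bh.timeSlab (τ₀ + 1)) 0).trans
            subset_union_left) }
  refine ⟨O', d, fun _ ↦ hsub, ?_, ⟨fun _ τ ↦ ρ τ + 1,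
    fun _ ↦ ⟨tendsto_atTop_add_const_right _ _ hρtop, fun τ ↦ ?_⟩, fun _ ↦ htrunc fun τ ↦ ρ τ + 1,
    fun τ₂ hτ₂ ↦ ?_⟩⟩
  · -- `O' = J⁺(ι X) ∩ I⁻(d.charted)`
    have hch : d.charted = Φ '' E (τ₀ + 1) := by
      apply Set.Subset.antisymm
      · rintro p (hp | hp)
        · exact hflatimg _ hp
        · obtain ⟨i, hi⟩ := Set.mem_iUnion.mp hp
          rwa [← himg]
      · intro p hp
        rw [← himg] at hp
        exact Or.inr (Set.mem_iUnion.mpr ⟨0, hp⟩)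
    rw [hch]
  · -- honest radii: `max(r₊, 0) + 1 = r₊ + 1 ≤ ρ τ ≤ ρ τ + 1`
    show max (Kerr.rPlus (M 0) (a 0)) 0 + 1 ≤ ρ τ + 1
    rw [hmax]
    linarith [hρge τ]
  · -- exhaustion at chart time `τ₂ > (τ₀ + 1)`
    have hτ₂' : τ₀ + 1 < τ₂ := hτ₂
    intro p hp
    have hp2 : p ∉ Φ '' E τ₂ := fun hp' ↦ hp.2 <| by
      rcases hsplit_late τ₂ hτ₂' hp' with h1 | h1
      · exact Or.inl h1
      · exact Or.inr (Set.mem_iUnion.mpr ⟨0, h1⟩)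
    have hJ := hexh τ₂ (by linarith) ⟨hO'O hp.1, hp2⟩
    refine LorentzianMetric.causalFuture_mono ?_ hJ
    intro q hq
    rcases hsplit_slab τ₂ hτ₂' hq with h1 | h1
    · exact Or.inl h1
    · exact Or.inr (Set.mem_iUnion.mpr ⟨0, h1⟩)

/-- **`InertialRecession`, static one-hole case — registered-stub form.** The previous theorem
`inertialRecession_staticHole` restated verbatim as one `∀`-telescope (the signature registered as stub
`inertialRecession_staticHole_holds` on the crux item it serves); proof: that theorem. [folklore] -/
theorem inertialRecession_staticHole_holds : open Literature.Geometry.Lorentzian in ∀ (X : Type) [TopologicalSpace X] [ChartedSpace E3 X] [IsManifold (𝓡 3) ((⊤ : ℕ∞) : WithTop ℕ∞) X] [ConnectedSpace X] (D : InitialDataSet (𝓡 3) X) (𝒟 : VacuumCauchyDevelopment D) (M a rin : Fin 1 → ℝ) (Λ : Fin 1 → ℝ → lorentzGroup) (ξ : Fin 1 → ℝ → E3) (γ κ τ₀ : ℝ) (U : Opens E4) (Φ : U → 𝒟.carrier) (O : Set 𝒟.carrier), (∀ t, Λ 0 t = 1) → (∀ t, ξ 0 t = ξ 0 0) → ((∀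 i, Kerr.IsSubextremal (M i) (a i) ∧ Kerr.rMinus (M i) (a i) < rin i ∧ rin i < Kerr.rPlus (M i) (a i)) ∧ (∀ i t, |((Λ i t : E4 ≃L[ℝ] E4) (E4.basisVector 0)) 0| ≤ γ) ∧ (∀ i, ContDiff ℝ ((⊤ : ℕ∞) : WithTop ℕ∞) (ξ i) ∧ ContDiff ℝ ((⊤ : ℕ∞) : WithTop ℕ∞) (fun t ↦ ((Λ i t : E4 ≃L[ℝ] E4) : E4 →L[ℝ] E4))) ∧ (∀ i j, i ≠ j → Tendsto (fun t ↦ ‖ξ i t - ξ j t‖) atTop atTop) ∧ (0 < κ ∧ κ < 1 ∧ ∀ i, ∀ᶠ t in atTop, ‖ξ i t‖ ≤ κ ^ 2 * t) ∧ ({x : E4 | τ₀ < x 0 ∧ ∀ i, rin i < Kerr.radius (a i) (poincareInv (Λ i (x 0)) (E4.ofTimeSpace (x 0) (ξ i (x 0))) x)} ⊆ (U : Set E4)) ∧ let B : ModelBackground := ⟨U, fun x ↦ Minkowski.bilin + ∑ i, (boostedKerrBilin (Λ i (x 0)) (E4.ofTimeSpace (x 0) (ξ i (x 0))) (M i) (a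 i) x - Minkowski.bilin), fun x ↦ x 0, E4.spatialNorm⟩; ContMDiff 𝓘(ℝ, E4) (𝓡 4) ((⊤ : ℕ∞) : WithTop ℕ∞) Φ ∧ Topology.IsOpenEmbedding ((B.lateRegion τ₀).restrict Φ) ∧ Φ '' {x : U | τ₀ < x.1 0 ∧ ∀ i, Kerr.rPlus (M i) (a i) < Kerr.radius (a i) (poincareInv (Λ i (x.1 0)) (E4.ofTimeSpace (x.1 0) (ξ i (x.1 0))) x.1)} ⊆ O ∧ Tendsto (fun t ↦ 𝒟.toSpacetime.deviationCk B Φ 3 t) atTop (𝓝 0) ∧ Tendsto (fun t : ℝ ↦ ⨆ x ∈ {x : U | x.1 0 = t ∧ E4.spatialNorm x.1 ≤ κ * t}, ⨆ (m : ℕ) (_ : m ≤ 3), ENNReal.ofReal (1 + √(√((⨅ i, ‖E4.spatial x.1 - ξ i t‖) ^ 7))) * ‖iteratedFDeriv ℝ m (𝒟.toSpacetime.deviationExtend B Φ) x.1‖ₑ) atTop (𝓝 0) ∧ O = Summit.FinalStateConjecture.exteriorOf 𝒟.toCauchyDevelopment (Φ '' {x : U | τ₀ < x.1 0 ∧ ∀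 i, Kerr.rPlus (M i) (a i) < Kerr.radius (a i) (poincareInv (Λ i (x.1 0)) (E4.ofTimeSpace (x.1 0) (ξ i (x.1 0))) x.1)}) ∧ ∀ t₁ : ℝ, τ₀ < t₁ → O \ Φ '' {x : U | t₁ < x.1 0 ∧ ∀ i, Kerr.rPlus (M i) (a i) < Kerr.radius (a i) (poincareInv (Λ i (x.1 0)) (E4.ofTimeSpace (x.1 0) (ξ i (x.1 0))) x.1)} ⊆ 𝒟.metric.causalPast 𝒟.timeOrientation (Φ '' {x : U | x.1 0 = t₁ ∧ ∀ i, Kerr.rPlus (M i) (a i) < Kerr.radius (a i) (poincareInv (Λ i (x.1 0)) (E4.ofTimeSpace (x.1 0) (ξ i (x.1 0))) x.1)})) → ∃ (O : Set 𝒟.carrier) (d : FinalStateDecomposition 𝒟.toSpacetime O 2), (∀ i, Kerr.IsSubextremal (d.mass i) (d.spin i)) ∧ O = Summit.FinalStateConjecture.exteriorOf 𝒟.toCauchyDevelopment d.charted ∧ Summit.FinalStateConjecture.HasExhaustiveCharts d :=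
  inertialRecession_staticHole

end Summit.FinalStateConjecture.FinalStateConjecture.Theorems

end
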